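import Mathlib

/-!
# KChain — a compatible thread of `K`-rational points over a tower of local `k`-algebras (Layer C2/C3 of the tower dictionary)

0-weight TOOL toward `TightDefectClasses.TowerDictionary` (decomp-res lens-5, g39; plan `NEXT-g40.md` §6, items C2 (thread) and C3 (residue field `K`)).
Pure commutative algebra, no schemes.

THE THREAD OF EMBEDDINGS.  Let `k ⊆ K` with `K` algebraically closed and let `B_0 → B_1 → B_2 → ⋯` be local homomorphisms of local `k`-algebras whose residue
fields `κ_i` are algebraic over `k` (`KResidue`).  Then there is a COMPATIBLE system of `k`-embeddings `ε_i : κ_i → K` (`ε_{i+1} ∘ (κ_i → κ_{i+1}) = ε_i`;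
`exists_thread`, by `IsAlgClosed.lift` one step at a time), and each `ε_i` defines the `K`-POINT
`𝔴_i = ker (B_i ⊗_k K → K, b ⊗ a ↦ ε_i(b̄)·a)` (`pointIdeal`) of the base change, which is

* maximal with residue field `K` — even `K`-RATIONAL in the strong form `∀ y ∈ (B_i ⊗_k K)/𝔴_i, ∃ a ∈ K, y = 1 ⊗ a` (`exists_one_tmul_mk_eq`, the producer of the
  hypothesis `hK` of `KThread.exists_sub_algebraMap_mem_maximalIdeal`);
* over the closed point: `𝔴_i ∩ B_i = 𝔪_{B_i}` (`comap_pointIdeal`);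
* COMPATIBLE along the tower: `𝔴_{i+1} ∩ (B_i ⊗_k K) = 𝔴_i` (`comap_map_pointIdeal`), so that the localisations `B̃_i = (B_i ⊗_k K)_{𝔴_i}` form a dominated chain.

`exists_pointThread` packages the four properties for a whole tower.  This replaces the lying-over / König arguments for geometric points of the fibres
`x_i ×_k K` by the one-line observation that a compatible choice of embeddings `κ_i ↪ K` IS a compatible choice of `K`-points.
All PROVED, 0 sorry.  [cite: ZariskiSamuel1958, Ch. III §15, Thm 40] (linear disjointness / base change of points); [cite: Matsumura1987, §5] (residue fields, base change).
-/

noncomputable section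

set_option linter.dupNamespace false

namespace Summit.ResolutionOfSingularities.ResolutionOfSingularities.Theorems.KChain

open TensorProduct IsLocalRing

/-! ## §1 One step: extending a residue embedding along a local homomorphism -/

section Step

variable {k K : Type} [Field k] [Field K] [Algebra k K] [IsAlgClosed K]
variable {B B' : Type} [CommRing B] [CommRing B'] [IsLocalRing B] [IsLocalRing B'] [Algebra k B] [Algebra k B']

/-- **One step.**  `f : B → B'` a local homomorphism of local `k`-algebras, `κ(B')` algebraic over `k`: every `k`-embedding `ε : κ(B) → K` into an
algebraically closed `K` extends along `κ(B) → κ(B')` to `ε' : κ(B') → K`. (`IsAlgClosed.lift`.) [folklore] -/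
theorem exists_algHom_extend (f : B →ₐ[k] B') [IsLocalHom f.toRingHom] [Algebra.IsAlgebraic k (ResidueField B')]
    (ε : ResidueField B →ₐ[k] K) :
    ∃ ε' : ResidueField B' →ₐ[k] K, ∀ x : ResidueField B, ε' (ResidueField.map f.toRingHom x) = ε x := by
  letI : Algebra B B' := f.toRingHom.toAlgebra
  haveI : IsScalarTower k B B' := IsScalarTower.of_algebraMap_eq fun c => (f.commutes c).symm
  haveI : IsLocalHom (algebraMap B B') := ‹IsLocalHom f.toRingHom›
  letI : Algebra (ResidueField B) K := ε.toRingHom.toAlgebra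
  haveI : IsScalarTower k (ResidueField B) K := IsScalarTower.of_algebraMap_eq fun c => (ε.commutes c).symm
  haveI : Algebra.IsAlgebraic (ResidueField B) (ResidueField B') :=
    Algebra.IsAlgebraic.tower_top (K := k) (L := ResidueField B) (A := ResidueField B')
  let ε' : ResidueField B' →ₐ[ResidueField B] K := IsAlgClosed.lift
  refine ⟨ε'.restrictScalars k, fun x => ?_⟩
  obtain ⟨x, rfl⟩ := residue_surjective x
  rw [AlgHom.restrictScalars_apply, ResidueField.map_residue]
  have h := ε'.commutes (residue B x)
  rw [ResidueField.algebraMap_residue] at h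
  exact h

end Step

/-! ## §2 The thread of embeddings over a tower -/

section Thread

variable {k K : Type} [Field k] [Field K] [Algebra k K] [IsAlgClosed K]
variable (B : ℕ → Type) [∀ i, CommRing (B i)] [∀ i, IsLocalRing (B i)] [∀ i, Algebra k (B i)]
  (f : ∀ i, B i →ₐ[k] B (i + 1)) [hf : ∀ i, IsLocalHom (f i).toRingHom] [halg : ∀ i, Algebra.IsAlgebraic k (ResidueField (B i))]

/-- **The thread.**  Over a tower `B_0 → B_1 → ⋯` of local homomorphisms of local `k`-algebras with residue fields algebraic over `k` there is a compatible
system of `k`-embeddings `ε_i : κ(B_i) → K` into any algebraically closed `K ⊇ k`. [folklore] -/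
theorem exists_thread (K : Type) [Field K] [Algebra k K] [IsAlgClosed K] :
    ∃ ε : ∀ i, ResidueField (B i) →ₐ[k] K, ∀ i (x : ResidueField (B i)), ε (i + 1) (ResidueField.map (f i).toRingHom x) = ε i x := by
  have step : ∀ i (εi : ResidueField (B i) →ₐ[k] K),
      ∃ ε' : ResidueField (B (i + 1)) →ₐ[k] K, ∀ x, ε' (ResidueField.map (f i).toRingHom x) = εi x :=
    fun i εi => exists_algHom_extend (f i) εi
  choose e he using step
  let ε0 : ResidueField (B 0) →ₐ[k] K := IsAlgClosed.lift
  exact ⟨fun i => Nat.rec (motive := fun i => ResidueField (B i) →ₐ[k] K) ε0 (fun i εi => e i εi) i, fun i x => he i _ x⟩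

end Thread

/-! ## §3 The `K`-point of `B ⊗_k K` defined by an embedding `κ(B) ↪ K` -/

section Point

variable (k K : Type) [Field k] [Field K] [Algebra k K]
variable {B : Type} [CommRing B] [IsLocalRing B] [Algebra k B]

/-- `Φ_ε : B ⊗_k K → K`, `b ⊗ a ↦ ε(b̄)·a`.  DEFINITION (support, data). -/
def pointMap (ε : ResidueField B →ₐ[k] K) : B ⊗[k] K →ₐ[k] K :=
  Algebra.TensorProduct.productMap (ε.comp (IsScalarTower.toAlgHom k B (ResidueField B))) (AlgHom.id k K)

/-- The `K`-POINT `𝔴_ε = ker Φ_ε` of the base change `B ⊗_k K`.  DEFINITION (support, data). -/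
def pointIdeal (ε : ResidueField B →ₐ[k] K) : Ideal (B ⊗[k] K) :=
  RingHom.ker (pointMap k K ε).toRingHom

variable {k K}

/-- `Φ_ε` on pure tensors: `Φ_ε (b ⊗ a) = ε(b̄) · a` (definitional). -/
@[simp] theorem pointMap_tmul (ε : ResidueField B →ₐ[k] K) (b : B) (a : K) :
    pointMap k K ε (b ⊗ₜ a) = ε (residue B b) * a := rfl

/-- Membership in the point ideal `𝔭_ε = ker Φ_ε` is vanishing under `Φ_ε` (definitional). -/
theorem mem_pointIdeal_iff (ε : ResidueField B →ₐ[k] K) (x : B ⊗[k] K) : x ∈ pointIdeal k K ε ↔ pointMap k K ε x = 0 :=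
  Iff.rfl

/-- `Φ_ε` is onto (`Φ_ε (1 ⊗ a) = a`). -/
theorem pointMap_surjective (ε : ResidueField B →ₐ[k] K) : Function.Surjective (pointMap k K ε) :=
  fun a => ⟨1 ⊗ₜ a, by simp⟩

/-- **`𝔴_ε` is maximal** (its residue ring is the field `K`). -/
theorem pointIdeal_isMaximal (ε : ResidueField B →ₐ[k] K) : (pointIdeal k K ε).IsMaximal :=
  RingHom.ker_isMaximal_of_surjective (pointMap k K ε).toRingHom (pointMap_surjective ε)

/-- **`𝔴_ε` lies over the closed point**: `𝔴_ε ∩ B = 𝔪_B`. -/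
theorem comap_pointIdeal (ε : ResidueField B →ₐ[k] K) :
    (pointIdeal k K ε).comap (algebraMap B (B ⊗[k] K)) = maximalIdeal B := by
  ext b
  rw [Ideal.mem_comap, mem_pointIdeal_iff, Algebra.TensorProduct.algebraMap_apply, Algebra.algebraMap_self, RingHom.id_apply,
    pointMap_tmul, mul_one, map_eq_zero_iff ε (RingHom.injective (ε : ResidueField B →+* K)), residue_eq_zero_iff]

/-- **`K`-rationality of `𝔴_ε`** (strong form): every class of `(B ⊗_k K)/𝔴_ε` is the class of some `1 ⊗ a`, `a ∈ K` — the producer of the hypothesis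
`hK` of `KThread.exists_sub_algebraMap_mem_maximalIdeal`. -/
theorem exists_one_tmul_mk_eq (ε : ResidueField B →ₐ[k] K) (y : (B ⊗[k] K) ⧸ pointIdeal k K ε) :
    ∃ a : K, Ideal.Quotient.mk (pointIdeal k K ε) ((1 : B) ⊗ₜ[k] a) = y := by
  obtain ⟨x, rfl⟩ := Ideal.Quotient.mk_surjective y
  refine ⟨pointMap k K ε x, ?_⟩
  rw [Ideal.Quotient.eq, mem_pointIdeal_iff, map_sub, pointMap_tmul, map_one, map_one, one_mul, sub_self]

/-- Equivalently: `x - 1 ⊗ Φ_ε(x) ∈ 𝔴_ε`. -/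
theorem sub_one_tmul_mem_pointIdeal (ε : ResidueField B →ₐ[k] K) (x : B ⊗[k] K) :
    x - (1 : B) ⊗ₜ[k] (pointMap k K ε x) ∈ pointIdeal k K ε := by
  rw [mem_pointIdeal_iff, map_sub, pointMap_tmul, map_one, map_one, one_mul, sub_self]

end Point

/-! ## §4 Compatibility along a local homomorphism -/

section Compat

variable {k K : Type} [Field k] [Field K] [Algebra k K]
variable {B B' : Type} [CommRing B] [CommRing B'] [IsLocalRing B] [IsLocalRing B'] [Algebra k B] [Algebra k B']

/-- If `ε'` extends `ε` along the local homomorphism `f : B → B'`, then `Φ_{ε'} ∘ (f ⊗ 1) = Φ_ε`. -/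
theorem pointMap_comp_map (f : B →ₐ[k] B') [IsLocalHom f.toRingHom] (ε : ResidueField B →ₐ[k] K) (ε' : ResidueField B' →ₐ[k] K)
    (h : ∀ x : ResidueField B, ε' (ResidueField.map f.toRingHom x) = ε x) :
    (pointMap k K ε').comp (Algebra.TensorProduct.map f (AlgHom.id k K)) = pointMap k K ε := by
  apply Algebra.TensorProduct.ext'
  intro b a
  rw [AlgHom.comp_apply, Algebra.TensorProduct.map_tmul, pointMap_tmul, pointMap_tmul, AlgHom.id_apply, ← h (residue B b),
    ResidueField.map_residue]
  rfl

/-- **Compatibility of the `K`-points**: `𝔴_{ε'} ∩ (B ⊗_k K) = 𝔴_ε` (pull-back along `f ⊗ 1`). -/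
theorem comap_map_pointIdeal (f : B →ₐ[k] B') [IsLocalHom f.toRingHom] (ε : ResidueField B →ₐ[k] K) (ε' : ResidueField B' →ₐ[k] K)
    (h : ∀ x : ResidueField B, ε' (ResidueField.map f.toRingHom x) = ε x) :
    (pointIdeal k K ε').comap (Algebra.TensorProduct.map f (AlgHom.id k K)).toRingHom = pointIdeal k K ε := by
  ext x
  rw [Ideal.mem_comap, mem_pointIdeal_iff, mem_pointIdeal_iff, ← pointMap_comp_map f ε ε' h]
  rfl

/-- Hence `f ⊗ 1` maps `𝔴_ε` into `𝔴_{ε'}` and its complement into the complement (domination of the localisations). -/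
theorem mem_pointIdeal_map_iff (f : B →ₐ[k] B') [IsLocalHom f.toRingHom] (ε : ResidueField B →ₐ[k] K) (ε' : ResidueField B' →ₐ[k] K)
    (h : ∀ x : ResidueField B, ε' (ResidueField.map f.toRingHom x) = ε x) (x : B ⊗[k] K) :
    Algebra.TensorProduct.map f (AlgHom.id k K) x ∈ pointIdeal k K ε' ↔ x ∈ pointIdeal k K ε := by
  rw [← comap_map_pointIdeal f ε ε' h, Ideal.mem_comap]
  rfl

end Compat

/-! ## §5 The thread of `K`-points over a tower -/

section PointThread

variable {k : Type} [Field k]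
variable (B : ℕ → Type) [∀ i, CommRing (B i)] [∀ i, IsLocalRing (B i)] [∀ i, Algebra k (B i)]
  (f : ∀ i, B i →ₐ[k] B (i + 1)) [hf : ∀ i, IsLocalHom (f i).toRingHom] [halg : ∀ i, Algebra.IsAlgebraic k (ResidueField (B i))]

/-- **The thread of `K`-points.**  Over a tower `B_0 → B_1 → ⋯` of local homomorphisms of local `k`-algebras with residue fields algebraic over `k`, and
`K ⊇ k` algebraically closed, there are ideals `𝔴_i ⊆ B_i ⊗_k K` which are (1) maximal, (2) over the closed points (`𝔴_i ∩ B_i = 𝔪_{B_i}`), (3)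
`K`-rational (`(B_i ⊗_k K)/𝔴_i` consists of classes of `1 ⊗ a`), and (4) compatible (`𝔴_{i+1} ∩ (B_i ⊗_k K) = 𝔴_i`).
[cite: ZariskiSamuel1958, Ch. III §15, Thm 40] -/
theorem exists_pointThread (K : Type) [Field K] [Algebra k K] [IsAlgClosed K] :
    ∃ W : ∀ i, Ideal (B i ⊗[k] K),
      (∀ i, (W i).IsMaximal) ∧
      (∀ i, (W i).comap (algebraMap (B i) (B i ⊗[k] K)) = maximalIdeal (B i)) ∧
      (∀ i (y : (B i ⊗[k] K) ⧸ W i), ∃ a : K, Ideal.Quotient.mk (W i) ((1 : B i) ⊗ₜ[k] a) = y) ∧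
      (∀ i, (W (i + 1)).comap (Algebra.TensorProduct.map (f i) (AlgHom.id k K)).toRingHom = W i) := by
  obtain ⟨ε, hε⟩ := exists_thread B f K
  exact ⟨fun i => pointIdeal k K (ε i), fun i => pointIdeal_isMaximal (ε i), fun i => comap_pointIdeal (ε i),
    fun i y => exists_one_tmul_mk_eq (ε i) y, fun i => comap_map_pointIdeal (f i) (ε i) (ε (i + 1)) (hε i)⟩

end PointThread

end Summit.ResolutionOfSingularities.ResolutionOfSingularities.Theorems.KChain
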